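import Literature.Computability.QuantumComplexity.StateVectorDP
import Literature.Computability.QuantumComplexity.HybridArgument
import HarnessLib

/-!
# Path sums for Clifford+`T` circuits WITH oracle gates, set weights, and exact `√2`-threshold tests

Topic `Literature/Computability/QuantumComplexity`, continuing `CliffordTPathSums.lean` (paths
`pathStep`/`pathRun`, the path-sum theorem `prodZeta_mulVec_basisState` and the pair counts
`pairSumA`/`pairSumB` with `2^h |⟨z|U|w⟩|² = A_z + (√2/2) B_z` — all for ORACLE-FREE gate lists)
and `StateVectorDP.lean` (the exact sign test `posSqrtTwoTest a b ↔ 0 < a + b√2`). Here the gate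
lists may contain oracle gates, each annotated with ITS OWN oracle language (`AnnGate`): this is
the shape of the circuits in the proof of Aaronson–Chen 2017, Lemma 5.3 (§5.3, pp. 22–23), where
the `t`-th `O`-gate of a `SampBQP^{TQBF,O}` circuit is replaced by the gate of the language
`TQBF ⊕ (O ∩ K_t)` of the currently known part of `O` (`AcSim.step`,
`Literature/Barriers/QuantumAdvantage/AaronsonChenSimulation.lean`), and whose classical
`SampBPP^{TQBF,O}` simulator must decide, EXACTLY and in polynomial space, (i) which query
strings are heavy ("we query all `x` with `Q(x) ≥ τ`") and (ii) the conditional Born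
probabilities of the final state ("it first takes a sample `z` by measuring `|v_{T+1}⟩` in the
computational basis"; "all the computations can be done in `PSPACE`").

An oracle gate `U_A |q, b⟩ = |q, b ⊕ [q ∈ A]⟩` is a permutation of the computational basis, so
it is a NON-BRANCHING path step (`Cryptography.oracleTarget`), and the whole path-sum calculus
goes through verbatim:

* `AnnGate N = QGate cliffordT N × Language Bool`, `annSem`, `annProd` (first gate rightmost),
  `annProd_map_const` (constant annotation `A` = `QCircuit.toMatrix A`);
* `annPathStep`, `annPathRun`, `annHCount`, `annPathAmp`, `annPathTerm`, the **path-sum theorem**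
  `annProd_mulVec_basisState(_apply)`: `⟨z|U|w⟩ = 2^{-h/2} Σ_{b : end(b) = z} ω^{φ(b)}`;
* `annPairDiff`, `annPairSumA`, `annPairSumB`, **`two_pow_mul_normSq_annAmp`**:
  `2^h |⟨z|U|w⟩|² = A_z + (√2/2) B_z` (integers);
* **set weights**: `annWeight gas w S = Σ_{z ∈ S} |⟨z|U|w⟩|²` for a set of labels `S`, the pair
  counts `annSetA`, `annSetB` over pairs of paths ending at the same label of `S` (the form a
  space-bounded machine enumerates), `two_pow_mul_annWeight` (`2^h W(S) = A_S + (√2/2) B_S`),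
  `queryWeight_eq_annWeight` (BBBV query magnitudes are set weights of query cylinders),
  `annWeight_le_one`;
* **exact tests**: `linFormTest c₀ c₁ c₂ A₁ B₁ A₂ B₂ := posSqrtTwoTest (2(c₁A₁ + c₂A₂ + c₀)) (c₁B₁ + c₂B₂)`
  and `linFormTest_iff`: it decides `0 < c₁·2^h W(S₁) + c₂·2^h W(S₂) + c₀` for integer
  coefficients — the heavy-query test `1/a ≤ Q(x)` (`le_annWeight_iff`) and the sampling
  comparisons `j·W(S) < 2^m·W(S')` (`mul_annWeight_lt_iff`) are instances.

## References

* S. Aaronson, L. Chen, *Complexity-theoretic foundations of quantum supremacy experiments*,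
  CCC 2017 (arXiv:1612.05903), §5.3 (pp. 22–23: "Construction and Analysis of g", "Analysis of the
  final circuit", "all the computations can be done in PSPACE") [AaronsonChen2017].
* L. M. Adleman, J. DeMarrais, M.-D. A. Huang, *Quantum computability*, SIAM J. Comput. 26 (1997),
  §6, Lemma 6.6 (path amplitudes), Lemma 6.10 (pairs of paths) [AdlemanDeMarraisHuang1997], as
  formalized oracle-free in `CliffordTPathSums.lean`.
* M. A. Nielsen, I. L. Chuang, *Quantum Computation and Quantum Information* (2010), §6.1.1,
  Eq. (6.2) (the oracle gate on basis states), as `Cryptography.placeGate_oracleGate_mulVec_basisState`.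
* E. Bernstein, U. Vazirani, *Quantum complexity theory*, SIAM J. Comput. 26 (1997), §8;
  C. H. Bennett, E. Bernstein, G. Brassard, U. Vazirani, SIAM J. Comput. 26 (1997), Def. 3.2
  (query magnitude) [BennettBernsteinBrassardVazirani1997].
-/

noncomputable section

namespace Literature.Computability.QuantumComplexity

open _root_.Computability Complexity Cryptography Matrix

variable {N : ℕ}

/-! ### Annotated gates and their semantics -/

/-- A Clifford+`T` gate with oracle gates ANNOTATED by their own oracle language (the language is
ignored for gate symbols). [cite: AaronsonChen2017, §5.3 (p. 22: "we replaced the f_{n_i} gate with a g_i gate")] -/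
abbrev AnnGate (N : ℕ) : Type := QGate cliffordT N × Language Bool

/-- The matrix of an annotated gate: the gate's matrix relative to its own language. [folklore] -/
def annSem (ga : AnnGate N) : Matrix (QReg N) (QReg N) ℂ := ga.1.toMatrix ga.2

/-- The matrix of an annotated gate list, first gate rightmost (as `QCircuit.toMatrix`). [folklore] -/
def annProd (gas : List (AnnGate N)) : Matrix (QReg N) (QReg N) ℂ := (gas.map annSem).reverse.prod

/-- The empty product. [folklore] -/
@[simp] theorem annProd_nil : annProd ([] : List (AnnGate N)) = 1 := by simp [annProd]

/-- Prepending a gate: it is the rightmost factor. [folklore] -/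
theorem annProd_cons (ga : AnnGate N) (gas : List (AnnGate N)) : annProd (ga :: gas) = annProd gas * annSem ga := by
  simp [annProd]

/-- Appending: the second list acts after the first. [folklore] -/
theorem annProd_append (gas gas' : List (AnnGate N)) : annProd (gas ++ gas') = annProd gas' * annProd gas := by
  simp [annProd, List.map_append, List.reverse_append, List.prod_append]

/-- With the constant annotation `A` the product is the circuit's matrix relative to `A`. [folklore] -/
theorem annProd_map_const (A : Language Bool) (gs : List (QGate cliffordT N)) :
    annProd (gs.map fun g => (g, A)) = (⟨gs⟩ : QCircuit cliffordT N).toMatrix A := by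
  induction gs with
  | nil => simp
  | cons g gs ih => rw [List.map_cons, annProd_cons, QCircuit.toMatrix_cons, ih]; rfl

/-- Annotated gate lists are unitary. [folklore] -/
theorem annProd_mem_unitaryGroup (gas : List (AnnGate N)) : annProd gas ∈ Matrix.unitaryGroup (QReg N) ℂ := by
  unfold annProd
  refine list_prod_mem fun M hM => ?_
  rw [List.mem_reverse, List.mem_map] at hM
  obtain ⟨ga, -, rfl⟩ := hM
  exact QGate.toMatrix_mem_unitaryGroup_holds cliffordT_isUnitary_holds ga.2 ga.1

/-- The output of an annotated gate list on a basis state is a unit vector. [folklore] -/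
theorem normSq_annProd_mulVec_basisState (gas : List (AnnGate N)) (w : QReg N) :
    normSq (annProd gas *ᵥ basisState w) = 1 := by
  rw [normSq_mulVec_of_mem_unitaryGroup (annProd_mem_unitaryGroup gas), normSq_basisState]

/-! ### Path steps through annotated gates -/

/-- **One path step through an annotated gate**: gate symbols step as in `pathStep`; an oracle
gate is non-branching (choice bit `0`) and moves `x` to `oracleTarget A e x` — its answer wire
XORed with `[q(x) ∈ A]` — with no phase. [cite: AdlemanDeMarraisHuang1997, §6 (p. 1534, paths)] [cite: NielsenChuang2010, §6.1.1 Eq. (6.2)] -/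
def annPathStep : AnnGate N → Bool → QReg N → Option (QReg N × ℕ)
  | (.gate g e, _), c, w => pathStep (.gate g e) c w
  | (.oracle _ e, A), c, w => if c then none else some (oracleTarget A e w, 0)

/-- A path through an annotated gate list, one choice bit per gate: endpoint and phase exponent,
or `none`. [cite: AdlemanDeMarraisHuang1997, §6 (p. 1534)] -/
def annPathRun : List (AnnGate N) → QReg N → List Bool → Option (QReg N × ℕ)
  | [], w, [] => some (w, 0)
  | [], _, _ :: _ => none
  | _ :: _, _, [] => none
  | ga :: gas, w, c :: cs =>
      match annPathStep ga c w with
      | none => none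
      | some (w', φ) => (annPathRun gas w' cs).map fun r => (r.1, φ + r.2)

/-- The number of Hadamard gates of an annotated list. [folklore] -/
def annHCount (gas : List (AnnGate N)) : ℕ := hCount (gas.map Prod.fst)

/-- `annHCount [] = 0`. [folklore] -/
@[simp] theorem annHCount_nil : annHCount ([] : List (AnnGate N)) = 0 := rfl

/-- Hadamard count of a cons. [folklore] -/
theorem annHCount_cons (ga : AnnGate N) (gas : List (AnnGate N)) :
    annHCount (ga :: gas) = annHCount gas + (if QGateIsH ga.1 then 1 else 0) := by
  simp [annHCount, hCount_cons]

/-- `annHCount ≤` length. [folklore] -/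
theorem annHCount_le_length (gas : List (AnnGate N)) : annHCount gas ≤ gas.length := by
  unfold annHCount; exact (hCount_le_length _).trans (by simp)

/-- Hadamard count of an append. [folklore] -/
theorem annHCount_append (gas gas' : List (AnnGate N)) : annHCount (gas ++ gas') = annHCount gas + annHCount gas' := by
  simp [annHCount, hCount, List.countP_append]

/-- The vector contributed by the step of `ga` with choice bit `c` from `|w⟩`. [folklore] -/
def annStepVec (ga : AnnGate N) (c : Bool) (w : QReg N) : QReg N → ℂ :=
  match annPathStep ga c w with
  | none => 0
  | some (w', φ) => (hCoef ga.1 * omega ^ φ) • basisState w'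

/-- **One annotated gate as a two-term path sum**: `annSem ga |w⟩ = Σ_c annStepVec ga c w`.
[cite: NielsenChuang2010, §4.2 and §6.1.1 Eq. (6.2)] -/
theorem annSem_mulVec_basisState (ga : AnnGate N) (w : QReg N) :
    annSem ga *ᵥ basisState w = ∑ c : Bool, annStepVec ga c w := by
  obtain ⟨g, A⟩ := ga
  cases g with
  | gate g e =>
    have hfree : (QGate.gate g e : QGate cliffordT N).IsOracleFree := trivial
    have h := semZeta_mulVec_basisState (ζ := omega) omega_pow_two hfree w
    rw [semZeta_omega A hfree] at h
    rw [annSem, h]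
    refine Finset.sum_congr rfl fun c _ => ?_
    cases g <;> rfl
  | oracle k e =>
    rw [annSem, QGate.toMatrix_oracle, placeGate_oracleGate_mulVec_basisState, Fintype.sum_bool]
    simp [annStepVec, annPathStep, hCoef, QGateIsH]

/-! ### The path sum of an annotated gate list -/

/-- The vector of the path with choice bits `bs` from `|w⟩`: `(2^{-h/2} ω^φ) |z⟩`, or `0`.
[cite: AdlemanDeMarraisHuang1997, §6 Lemma 6.6] -/
def annPathAmp (gas : List (AnnGate N)) (w : QReg N) (bs : List Bool) : QReg N → ℂ :=
  match annPathRun gas w bs with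
  | none => 0
  | some (z, φ) => (invSqrt2 ^ annHCount gas * omega ^ φ) • basisState z

/-- The empty path. [folklore] -/
@[simp] theorem annPathAmp_nil_nil (w : QReg N) : annPathAmp [] w [] = basisState w := by
  simp [annPathAmp, annPathRun]

/-- Peeling the first step off a path vector. [folklore] -/
theorem annPathAmp_cons (ga : AnnGate N) (gas : List (AnnGate N)) (w : QReg N) (c : Bool) (bs : List Bool) :
    annPathAmp (ga :: gas) w (c :: bs) =
      match annPathStep ga c w with
      | none => 0
      | some (w', φ) => (hCoef ga.1 * omega ^ φ) • annPathAmp gas w' bs := by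
  unfold annPathAmp
  simp only [annPathRun]
  cases annPathStep ga c w with
  | none => rfl
  | some p =>
    obtain ⟨w', φ⟩ := p
    simp only
    cases annPathRun gas w' bs with
    | none => simp
    | some q =>
      obtain ⟨z, ψ⟩ := q
      simp only [Option.map_some, annHCount_cons, smul_smul]
      congr 1
      simp only [hCoef, pow_add]
      split_ifs <;> ring

/-- **Path-sum theorem with oracle gates**: `annProd gas |w⟩ = Σ_b annPathAmp gas w b`.
[cite: AdlemanDeMarraisHuang1997, §6 (p. 1535, amp = Σ_p ρ_p)] [cite: AaronsonChen2017, §5.3 (p. 23, "Analysis of the final circuit")] -/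
theorem annProd_mulVec_basisState (gas : List (AnnGate N)) (w : QReg N) :
    annProd gas *ᵥ basisState w = ∑ b : Fin gas.length → Bool, annPathAmp gas w (List.ofFn b) := by
  induction gas generalizing w with
  | nil => simp
  | cons ga gas ih =>
    rw [annProd_cons, ← Matrix.mulVec_mulVec, annSem_mulVec_basisState, Matrix.mulVec_sum]
    rw [show (∑ b : Fin (ga :: gas).length → Bool, annPathAmp (ga :: gas) w (List.ofFn b)) =
        ∑ p : Bool × (Fin gas.length → Bool),
          annPathAmp (ga :: gas) w (List.ofFn (Fin.cons p.1 p.2 : Fin (gas.length + 1) → Bool)) from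
      ((Fin.consEquiv fun _ => Bool).sum_comp
        (fun b : Fin (gas.length + 1) → Bool => annPathAmp (ga :: gas) w (List.ofFn b))).symm,
      Fintype.sum_prod_type]
    refine Finset.sum_congr rfl fun c _ => ?_
    simp only [List.ofFn_cons, annPathAmp_cons]
    unfold annStepVec
    cases annPathStep ga c w with
    | none => simp
    | some p =>
      obtain ⟨w', φ⟩ := p
      simp only [Matrix.mulVec_smul, ih w', Finset.smul_sum]

/-- The scalar contributed at `z` by the path `bs`: `ω^φ` if valid and ending at `z`, else `0`.
[cite: AdlemanDeMarraisHuang1997, §6 (p. 1534, ρ_p)] -/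
def annPathTerm (gas : List (AnnGate N)) (w z : QReg N) (bs : List Bool) : ℂ :=
  match annPathRun gas w bs with
  | none => 0
  | some (z', φ) => if z' = z then omega ^ φ else 0

/-- Entries of a path vector. [folklore] -/
theorem annPathAmp_apply (gas : List (AnnGate N)) (w : QReg N) (bs : List Bool) (z : QReg N) :
    annPathAmp gas w bs z = invSqrt2 ^ annHCount gas * annPathTerm gas w z bs := by
  unfold annPathAmp annPathTerm
  cases annPathRun gas w bs with
  | none => simp
  | some p =>
    obtain ⟨z', φ⟩ := p
    by_cases h : z' = z
    · subst h; simp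
    · simp [h, Ne.symm h]

/-- **Amplitudes as path sums**: `⟨z| annProd gas |w⟩ = 2^{-h/2} Σ_b annPathTerm gas w z b`.
[cite: AdlemanDeMarraisHuang1997, §6 (pp. 1535–1536)] -/
theorem annProd_mulVec_basisState_apply (gas : List (AnnGate N)) (w z : QReg N) :
    (annProd gas *ᵥ basisState w) z =
      invSqrt2 ^ annHCount gas * ∑ b : Fin gas.length → Bool, annPathTerm gas w z (List.ofFn b) := by
  rw [annProd_mulVec_basisState gas w, Finset.sum_apply, Finset.mul_sum]
  exact Finset.sum_congr rfl fun b _ => annPathAmp_apply gas w _ z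

/-! ### Squared amplitudes as pair counts -/

/-- The phase-difference class `(φ − φ') mod 8` of a pair of paths both ending at `z`, else `none`.
[cite: AdlemanDeMarraisHuang1997, §6 Lemma 6.10 (proof)] -/
def annPairDiff (gas : List (AnnGate N)) (w z : QReg N) (bs bs' : List Bool) : Option ℕ :=
  match annPathRun gas w bs, annPathRun gas w bs' with
  | some (z₁, φ), some (z₂, φ') => if z₁ = z ∧ z₂ = z then some ((φ + 7 * φ') % 8) else none
  | _, _ => none

/-- Phase-difference classes are residues mod `8`. [folklore] -/
theorem lt_of_annPairDiff_eq_some {gas : List (AnnGate N)} {w z : QReg N} {bs bs' : List Bool}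
    {d : ℕ} (h : annPairDiff gas w z bs bs' = some d) : d < 8 := by
  unfold annPairDiff at h
  rcases h1 : annPathRun gas w bs with _ | ⟨z₁, φ⟩ <;> rcases h2 : annPathRun gas w bs' with _ | ⟨z₂, φ'⟩ <;>
    simp only [h1, h2] at h
  · exact absurd h (by simp)
  · exact absurd h (by simp)
  · exact absurd h (by simp)
  · by_cases hz : z₁ = z ∧ z₂ = z
    · rw [if_pos hz, Option.some.injEq] at h
      omega
    · rw [if_neg hz] at h
      exact absurd h (by simp)

/-- The integer part `A_z = Σ_{(b,b')} reA (annPairDiff b b')` of the pair sum at `z`.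
[cite: AdlemanDeMarraisHuang1997, §6 Lemma 6.10 (proof)] -/
def annPairSumA (gas : List (AnnGate N)) (w z : QReg N) : ℤ :=
  ∑ b : Fin gas.length → Bool, ∑ b' : Fin gas.length → Bool,
    match annPairDiff gas w z (List.ofFn b) (List.ofFn b') with
    | some d => reA d
    | none => 0

/-- The `√2/2`-part `B_z = Σ_{(b,b')} reB (annPairDiff b b')` of the pair sum at `z`.
[cite: AdlemanDeMarraisHuang1997, §6 Lemma 6.10 (proof)] -/
def annPairSumB (gas : List (AnnGate N)) (w z : QReg N) : ℤ :=
  ∑ b : Fin gas.length → Bool, ∑ b' : Fin gas.length → Bool,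
    match annPairDiff gas w z (List.ofFn b) (List.ofFn b') with
    | some d => reB d
    | none => 0

/-- The product of a path term and a conjugate path term is `ω^{annPairDiff}`. [folklore] -/
theorem annPathTerm_mul_star (gas : List (AnnGate N)) (w z : QReg N) (bs bs' : List Bool) :
    annPathTerm gas w z bs * star (annPathTerm gas w z bs') =
      match annPairDiff gas w z bs bs' with
      | some d => omega ^ d
      | none => 0 := by
  unfold annPathTerm annPairDiff
  rcases annPathRun gas w bs with _ | ⟨z₁, φ⟩ <;> rcases annPathRun gas w bs' with _ | ⟨z₂, φ'⟩
  · simp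
  · simp
  · simp
  · simp only
    by_cases h1 : z₁ = z
    · by_cases h2 : z₂ = z
      · have hc : (z₁ = z ∧ z₂ = z) := ⟨h1, h2⟩
        rw [if_pos h1, if_pos h2, if_pos hc]
        dsimp only
        rw [star_pow, star_omega, ← pow_mul, ← pow_add, zeta_pow_mod_eight omega_pow_eight]
      · have hc : ¬(z₁ = z ∧ z₂ = z) := fun h => h2 h.2
        rw [if_pos h1, if_neg h2, if_neg hc, star_zero, mul_zero]
    · have hc : ¬(z₁ = z ∧ z₂ = z) := fun h => h1 h.1
      rw [if_neg h1, if_neg hc, zero_mul]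

/-- **Squared amplitudes as pair counts, with oracle gates**:
`2^h |⟨z| annProd gas |w⟩|² = A_z + (√2/2) B_z`. [cite: AdlemanDeMarraisHuang1997, §6 Lemma 6.10 (proof, p. 1539)] [cite: AaronsonChen2017, §5.3 (p. 23)] -/
theorem two_pow_mul_normSq_annAmp (gas : List (AnnGate N)) (w z : QReg N) :
    (2 : ℝ) ^ annHCount gas * ‖(annProd gas *ᵥ basisState w) z‖ ^ 2 =
      annPairSumA gas w z + (Real.sqrt 2 / 2) * annPairSumB gas w z := by
  rw [annProd_mulVec_basisState_apply gas w z, norm_mul, mul_pow, ← mul_assoc,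
    two_pow_mul_norm_invSqrt2_pow_sq, one_mul, norm_sum_sq_eq_sum_sum_re]
  simp only [annPathTerm_mul_star, annPairSumA, annPairSumB, Int.cast_sum, Finset.mul_sum,
    ← Finset.sum_add_distrib]
  refine Finset.sum_congr rfl fun b _ => Finset.sum_congr rfl fun b' _ => ?_
  rcases hd : annPairDiff gas w z (List.ofFn b) (List.ofFn b') with _ | d
  · simp
  · simp only [omega_pow_re d (lt_of_annPairDiff_eq_some hd)]
    ring

/-! ### Set weights and their pair counts -/

/-- **The weight of a set of labels** `S` in the output of `gas` on `|w⟩`: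
`W(S) = Σ_{z ∈ S} |⟨z|U|w⟩|²` (a marginal/conditional Born weight, or a query magnitude).
[cite: AaronsonChen2017, §5.3 (p. 22: "the probability that this measurement returns a particular result"; p. 23: measuring |v_{T+1}⟩)] -/
def annWeight (gas : List (AnnGate N)) (w : QReg N) (S : Set (QReg N)) : ℝ :=
  open scoped Classical in ∑ z : QReg N, if z ∈ S then ‖(annProd gas *ᵥ basisState w) z‖ ^ 2 else 0

/-- Set weights are nonnegative. [folklore] -/
theorem annWeight_nonneg (gas : List (AnnGate N)) (w : QReg N) (S : Set (QReg N)) : 0 ≤ annWeight gas w S := by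
  classical
  exact Finset.sum_nonneg fun z _ => by split_ifs <;> positivity

/-- Set weights are at most `1`. [folklore] -/
theorem annWeight_le_one (gas : List (AnnGate N)) (w : QReg N) (S : Set (QReg N)) : annWeight gas w S ≤ 1 := by
  classical
  rw [← normSq_annProd_mulVec_basisState gas w, normSq]
  exact Finset.sum_le_sum fun z _ => by split_ifs <;> first | exact le_rfl | positivity

/-- Set weights are monotone. [folklore] -/
theorem annWeight_mono (gas : List (AnnGate N)) (w : QReg N) {S T : Set (QReg N)} (h : S ⊆ T) :
    annWeight gas w S ≤ annWeight gas w T := by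
  classical
  refine Finset.sum_le_sum fun z _ => ?_
  by_cases hz : z ∈ S
  · rw [if_pos hz, if_pos (h hz)]
  · rw [if_neg hz]; split_ifs <;> positivity

/-- The weight of the whole basis is `1`. [folklore] -/
theorem annWeight_univ (gas : List (AnnGate N)) (w : QReg N) : annWeight gas w Set.univ = 1 := by
  classical
  rw [← normSq_annProd_mulVec_basisState gas w, normSq]
  exact Finset.sum_congr rfl fun z _ => by simp

/-- Set weights are additive on disjoint sets. [folklore] -/
theorem annWeight_union (gas : List (AnnGate N)) (w : QReg N) {S T : Set (QReg N)} (h : Disjoint S T) :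
    annWeight gas w (S ∪ T) = annWeight gas w S + annWeight gas w T := by
  classical
  unfold annWeight
  rw [← Finset.sum_add_distrib]
  refine Finset.sum_congr rfl fun z _ => ?_
  by_cases hS : z ∈ S
  · have hT : z ∉ T := Set.disjoint_left.1 h hS
    simp [hS, hT]
  · by_cases hT : z ∈ T <;> simp [hS, hT]

/-- **BBBV query magnitudes are set weights**: `queryWeight D e (U|w⟩) = W({x : queryOf e x ∈ D})`.
[cite: BennettBernsteinBrassardVazirani1997, Def. 3.2] -/
theorem queryWeight_eq_annWeight {k : ℕ} (D : Set (List Bool)) (e : Fin (k + 1) ↪ Fin N)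
    (gas : List (AnnGate N)) (w : QReg N) :
    queryWeight D e (annProd gas *ᵥ basisState w) = annWeight gas w {x | queryOf e x ∈ D} := by
  classical
  unfold queryWeight annWeight
  exact Finset.sum_congr rfl fun z _ => by simp only [Set.mem_setOf_eq]; split_ifs <;> rfl

/-- The pair count `A_S = Σ_{(b,b')} [end b = end b' ∈ S] reA(d)` of a set of labels — the sum a
space-bounded machine accumulates while enumerating all pairs of paths.
[cite: AdlemanDeMarraisHuang1997, §6 Lemma 6.10 (proof)] [cite: AaronsonChen2017, §5.3 (p. 23, "all the computations can be done in PSPACE")] -/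
def annSetA (gas : List (AnnGate N)) (w : QReg N) (S : Set (QReg N)) : ℤ :=
  open scoped Classical in
  ∑ b : Fin gas.length → Bool, ∑ b' : Fin gas.length → Bool,
    match annPathRun gas w (List.ofFn b), annPathRun gas w (List.ofFn b') with
    | some (z₁, φ), some (z₂, φ') => if z₁ = z₂ ∧ z₁ ∈ S then reA ((φ + 7 * φ') % 8) else 0
    | _, _ => 0

/-- The pair count `B_S` of a set of labels. [cite: AdlemanDeMarraisHuang1997, §6 Lemma 6.10 (proof)] -/
def annSetB (gas : List (AnnGate N)) (w : QReg N) (S : Set (QReg N)) : ℤ :=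
  open scoped Classical in
  ∑ b : Fin gas.length → Bool, ∑ b' : Fin gas.length → Bool,
    match annPathRun gas w (List.ofFn b), annPathRun gas w (List.ofFn b') with
    | some (z₁, φ), some (z₂, φ') => if z₁ = z₂ ∧ z₁ ∈ S then reB ((φ + 7 * φ') % 8) else 0
    | _, _ => 0

open scoped Classical in
/-- The pair summand of `annSetA`/`annSetB` is the sum over `z ∈ S` of the per-label summands. [folklore] -/
theorem annSet_summand_eq (f : ℕ → ℤ) (gas : List (AnnGate N)) (w : QReg N) (S : Set (QReg N)) (bs bs' : List Bool) :
    (match annPathRun gas w bs, annPathRun gas w bs' with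
      | some (z₁, φ), some (z₂, φ') => if z₁ = z₂ ∧ z₁ ∈ S then f ((φ + 7 * φ') % 8) else 0
      | _, _ => (0 : ℤ)) =
      ∑ z : QReg N, if z ∈ S then (match annPairDiff gas w z bs bs' with | some d => f d | none => 0) else 0 := by
  classical
  unfold annPairDiff
  rcases annPathRun gas w bs with _ | ⟨z₁, φ⟩ <;> rcases annPathRun gas w bs' with _ | ⟨z₂, φ'⟩
  · simp
  · simp
  · simp
  · simp only
    by_cases h : z₁ = z₂ ∧ z₁ ∈ S
    · obtain ⟨rfl, hS⟩ := h
      rw [if_pos ⟨rfl, hS⟩, Finset.sum_eq_single z₁]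
      · rw [if_pos hS, if_pos ⟨rfl, rfl⟩]
      · intro z _ hz
        by_cases hzS : z ∈ S
        · rw [if_pos hzS, if_neg (fun h => hz h.1.symm)]
        · rw [if_neg hzS]
      · simp
    · rw [if_neg h]
      symm
      refine Finset.sum_eq_zero fun z _ => ?_
      by_cases hzS : z ∈ S
      · rw [if_pos hzS, if_neg]
        rintro ⟨rfl, rfl⟩
        exact h ⟨rfl, hzS⟩
      · rw [if_neg hzS]

open scoped Classical in
/-- `A_S = Σ_{z ∈ S} A_z`. [folklore] -/
theorem annSetA_eq_sum (gas : List (AnnGate N)) (w : QReg N) (S : Set (QReg N)) :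
    annSetA gas w S = ∑ z : QReg N, if z ∈ S then annPairSumA gas w z else 0 := by
  classical
  calc annSetA gas w S
      = ∑ b : Fin gas.length → Bool, ∑ b' : Fin gas.length → Bool, ∑ z : QReg N,
          (if z ∈ S then (match annPairDiff gas w z (List.ofFn b) (List.ofFn b') with | some d => reA d | none => 0) else 0) := by
        unfold annSetA
        exact Finset.sum_congr rfl fun b _ => Finset.sum_congr rfl fun b' _ => annSet_summand_eq reA gas w S _ _
    _ = ∑ b : Fin gas.length → Bool, ∑ z : QReg N, ∑ b' : Fin gas.length → Bool,
          (if z ∈ S then (match annPairDiff gas w z (List.ofFn b) (List.ofFn b') with | some d => reA d | none => 0) else 0) :=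
        Finset.sum_congr rfl fun b _ => Finset.sum_comm
    _ = ∑ z : QReg N, ∑ b : Fin gas.length → Bool, ∑ b' : Fin gas.length → Bool,
          (if z ∈ S then (match annPairDiff gas w z (List.ofFn b) (List.ofFn b') with | some d => reA d | none => 0) else 0) :=
        Finset.sum_comm
    _ = ∑ z : QReg N, if z ∈ S then annPairSumA gas w z else 0 := by
        refine Finset.sum_congr rfl fun z _ => ?_
        by_cases hz : z ∈ S
        · simp only [if_pos hz, annPairSumA]
        · simp only [if_neg hz, Finset.sum_const_zero]

open scoped Classical in
/-- `B_S = Σ_{z ∈ S} B_z`. [folklore] -/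
theorem annSetB_eq_sum (gas : List (AnnGate N)) (w : QReg N) (S : Set (QReg N)) :
    annSetB gas w S = ∑ z : QReg N, if z ∈ S then annPairSumB gas w z else 0 := by
  classical
  calc annSetB gas w S
      = ∑ b : Fin gas.length → Bool, ∑ b' : Fin gas.length → Bool, ∑ z : QReg N,
          (if z ∈ S then (match annPairDiff gas w z (List.ofFn b) (List.ofFn b') with | some d => reB d | none => 0) else 0) := by
        unfold annSetB
        exact Finset.sum_congr rfl fun b _ => Finset.sum_congr rfl fun b' _ => annSet_summand_eq reB gas w S _ _
    _ = ∑ b : Fin gas.length → Bool, ∑ z : QReg N, ∑ b' : Fin gas.length → Bool,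
          (if z ∈ S then (match annPairDiff gas w z (List.ofFn b) (List.ofFn b') with | some d => reB d | none => 0) else 0) :=
        Finset.sum_congr rfl fun b _ => Finset.sum_comm
    _ = ∑ z : QReg N, ∑ b : Fin gas.length → Bool, ∑ b' : Fin gas.length → Bool,
          (if z ∈ S then (match annPairDiff gas w z (List.ofFn b) (List.ofFn b') with | some d => reB d | none => 0) else 0) :=
        Finset.sum_comm
    _ = ∑ z : QReg N, if z ∈ S then annPairSumB gas w z else 0 := by
        refine Finset.sum_congr rfl fun z _ => ?_
        by_cases hz : z ∈ S
        · simp only [if_pos hz, annPairSumB]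
        · simp only [if_neg hz, Finset.sum_const_zero]

/-- **Set weights as pair counts**: `2^h · W(S) = A_S + (√2/2) B_S`.
[cite: AdlemanDeMarraisHuang1997, §6 Lemma 6.10 (proof)] [cite: AaronsonChen2017, §5.3 (p. 23)] -/
theorem two_pow_mul_annWeight (gas : List (AnnGate N)) (w : QReg N) (S : Set (QReg N)) :
    (2 : ℝ) ^ annHCount gas * annWeight gas w S = annSetA gas w S + (Real.sqrt 2 / 2) * annSetB gas w S := by
  classical
  rw [annSetA_eq_sum, annSetB_eq_sum, annWeight, Finset.mul_sum]
  push_cast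
  rw [Finset.mul_sum, ← Finset.sum_add_distrib]
  refine Finset.sum_congr rfl fun z _ => ?_
  by_cases hz : z ∈ S
  · simp only [if_pos hz, two_pow_mul_normSq_annAmp]
  · simp [hz]

/-! ### Exact threshold tests -/

/-- **The linear-form test** on two pairs of pair counts with integer coefficients:
`posSqrtTwoTest (2(c₁A₁ + c₂A₂ + c₀)) (c₁B₁ + c₂B₂)`, i.e. `0 < c₁(A₁ + (√2/2)B₁) + c₂(A₂ + (√2/2)B₂) + c₀`
decided by integer arithmetic. [folklore] -/
def linFormTest (c₀ c₁ c₂ A₁ B₁ A₂ B₂ : ℤ) : Bool :=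
  posSqrtTwoTest (2 * (c₁ * A₁ + c₂ * A₂ + c₀)) (c₁ * B₁ + c₂ * B₂)

/-- Correctness of the linear-form test. [folklore] -/
theorem linFormTest_iff (c₀ c₁ c₂ A₁ B₁ A₂ B₂ : ℤ) :
    linFormTest c₀ c₁ c₂ A₁ B₁ A₂ B₂ = true ↔
      (0 : ℝ) < c₁ * (A₁ + (Real.sqrt 2 / 2) * B₁) + c₂ * (A₂ + (Real.sqrt 2 / 2) * B₂) + c₀ := by
  rw [linFormTest, posSqrtTwoTest_iff]
  push_cast
  constructor <;> intro h <;> nlinarith [h]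

/-- **The test on set weights**: for sets `S₁, S₂` of labels of the output of `gas` on `|w⟩`
(`h` Hadamard gates), `linFormTest c₀ c₁ c₂ A_{S₁} B_{S₁} A_{S₂} B_{S₂}` decides
`0 < c₁ 2^h W(S₁) + c₂ 2^h W(S₂) + c₀`. [cite: AaronsonChen2017, §5.3 (pp. 22–23)] -/
theorem linFormTest_annSet_iff (c₀ c₁ c₂ : ℤ) (gas : List (AnnGate N)) (w : QReg N) (S₁ S₂ : Set (QReg N)) :
    linFormTest c₀ c₁ c₂ (annSetA gas w S₁) (annSetB gas w S₁) (annSetA gas w S₂) (annSetB gas w S₂) = true ↔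
      (0 : ℝ) < c₁ * ((2 : ℝ) ^ annHCount gas * annWeight gas w S₁) +
        c₂ * ((2 : ℝ) ^ annHCount gas * annWeight gas w S₂) + c₀ := by
  rw [linFormTest_iff, two_pow_mul_annWeight, two_pow_mul_annWeight]

/-- **The heavy-query test** `1/a ≤ W(S)` (`a > 0`): it fails iff `0 < 2^h − a · 2^h W(S)`, an
instance of the linear-form test with `c₁ = −a`, `c₂ = 0`, `c₀ = 2^h`.
[cite: AaronsonChen2017, §5.3 (p. 22: "we query all x ∈ {0,1}^{2n} with Q(x) ≥ τ")] -/
theorem le_annWeight_iff {a : ℕ} (ha : 0 < a) (gas : List (AnnGate N)) (w : QReg N) (S : Set (QReg N)) :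
    (1 : ℝ) / a ≤ annWeight gas w S ↔
      linFormTest (2 ^ annHCount gas) (-(a : ℤ)) 0 (annSetA gas w S) (annSetB gas w S) 0 0 = false := by
  have key := linFormTest_iff (2 ^ annHCount gas) (-(a : ℤ)) 0 (annSetA gas w S) (annSetB gas w S) 0 0
  rw [← two_pow_mul_annWeight] at key
  have ha' : (0 : ℝ) < a := by exact_mod_cast ha
  have hp : (0 : ℝ) < (2 : ℝ) ^ annHCount gas := by positivity
  rw [← Bool.not_eq_true, key, div_le_iff₀ ha']
  push_cast
  constructor
  · intro h hlt; nlinarith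
  · intro h; nlinarith [mul_comm (annWeight gas w S) (a : ℝ)]

/-- **The sampling comparison** `j · W(S₂) < M · W(S₁)` (conditional probability `W(S₁)/W(S₂)`
against the dyadic threshold `j/M`): the linear-form test with `c₁ = M`, `c₂ = −j`, `c₀ = 0`.
[cite: AaronsonChen2017, §5.3 (p. 23: "it first takes a sample z by measuring |v_{T+1}⟩ in the computational basis")] -/
theorem mul_annWeight_lt_iff (j M : ℤ) (gas : List (AnnGate N)) (w : QReg N) (S₁ S₂ : Set (QReg N)) :
    (j : ℝ) * annWeight gas w S₂ < M * annWeight gas w S₁ ↔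
      linFormTest 0 M (-j) (annSetA gas w S₁) (annSetB gas w S₁) (annSetA gas w S₂) (annSetB gas w S₂) = true := by
  rw [linFormTest_annSet_iff]
  have hp : (0 : ℝ) < (2 : ℝ) ^ annHCount gas := by positivity
  push_cast
  constructor
  · intro h; nlinarith
  · intro h; nlinarith

end Literature.Computability.QuantumComplexity

end
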